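import Mathlib.Analysis.InnerProductSpace.Adjoint
import Mathlib.Analysis.Normed.Operator.Compact.Basic
import HarnessLib

/-!
# ENGINE-KL layer (K4d, algebra) for `SqueezedSkewness.TorusKL` (stmt-QuantumFields-23204, stub `stub_torusMixtureData`):
# THE KÄLLÉN–LEHMANN DATUM OF ONE REFERENCE STATE

Pure Hilbert-space algebra (Mathlib only), generic complex inner-product space `H`.  Given a self-adjoint positive `A` with a unit
eigenvector `A e = λ e`, `λ > 0`, a norm-preserving representation `W` of an additive group commuting with `A` and FIXING `e`, and a
vector `ξ` (in the application: `e` = a joint eigenvector of transfer operator and translations, `W` = the character-twisted translations,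
`ξ = X'₀ e` the bond operator at the origin applied to `e`):
* §1 the rank-one projection `R v = ⟪e, v⟫ e`, the complementary projection `Π = 1 − R`, the operator `P = λ⁻¹ Π A Π` (self-adjoint,
  compact with `A`, positive, commuting with `W`, `P e = 0`, `P = λ⁻¹ A` on `e^⊥`);
* §2 ★ `inner_pow_mixture` — for `t, t' ≥ 1`:
  `⟪W x ξ, A^{t+t'} (W y ξ)⟫ = λ^{t+t'} (‖⟪e, ξ⟫‖² + ⟪P^{t−1} (W x ψ), P^{t'−1} (W y ψ)⟫)`, `ψ = P (ξ − ⟪e,ξ⟫ e)`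
  — the VACUUM-TYPE ATOM `|⟪e,ξ⟫|²` splits off and the rest is a Gram matrix of the vectors `P^{t−1} W x ψ` (the per-reference-state form of
  `stub_torusMixtureData`); also `⟪e, W x ξ⟫ = ⟪e, ξ⟫`.
Seat `ym-line-fcl-p3` g16; theorems only; nothing about a summit, NT or the mass gap.  [folklore]
References: M. Reed, B. Simon, *Methods of Modern Mathematical Physics I* (1980), §VI [cite: ReedSimonI1980, Thm VI.16].
-/

set_option autoImplicit false

noncomputable section

open scoped InnerProductSpace ComplexConjugate

namespace Summit.QuantumFields.YangMills.Theorems.TorusKL.MixtureAlgebra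

variable {H : Type*} [NormedAddCommGroup H] [InnerProductSpace ℂ H]

section RankOne

/-! ## §1 The projected operator `P = λ⁻¹ Π A Π` -/

/-- The rank-one map `R v = ⟪e, v⟫ e`. [folklore] -/
theorem rankOne_apply (e v : H) : ((innerSL ℂ e).smulRight e) v = ⟪e, v⟫_ℂ • e := by
  rw [ContinuousLinearMap.smulRight_apply, innerSL_apply_apply]

/-- `R e = e` for a unit vector. [folklore] -/
theorem rankOne_apply_self {e : H} (he : ‖e‖ = 1) : ((innerSL ℂ e).smulRight e) e = e := by
  rw [rankOne_apply, inner_self_eq_norm_sq_to_K, he]; simp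

/-- `R v = 0` for `v ⊥ e`. [folklore] -/
theorem rankOne_apply_of_orthogonal {e v : H} (hv : ⟪e, v⟫_ℂ = 0) : ((innerSL ℂ e).smulRight e) v = 0 := by
  rw [rankOne_apply, hv, zero_smul]

/-- An operator fixing `e` and preserving norms commutes with `R`. [folklore] -/
theorem rankOne_comm {e : H} {W : H →L[ℂ] H} (hWe : W e = e) (hWadj : ∀ v, ⟪e, W v⟫_ℂ = ⟪e, v⟫_ℂ) :
    (innerSL ℂ e).smulRight e * W = W * (innerSL ℂ e).smulRight e := by
  ext v
  rw [mul_apply_eq_comp, mul_apply_eq_comp, rankOne_apply, rankOne_apply, hWadj, map_smul, hWe]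

end RankOne

variable [CompleteSpace H] {A : H →L[ℂ] H} {e : H} {lam : ℝ}

/-- `R` is self-adjoint. [folklore] -/
theorem rankOne_isSelfAdjoint (e : H) : IsSelfAdjoint ((innerSL ℂ e).smulRight e) := by
  rw [ContinuousLinearMap.isSelfAdjoint_iff_isSymmetric]
  intro v w
  simp only [ContinuousLinearMap.coe_coe, rankOne_apply, inner_smul_left, inner_smul_right, inner_conj_symm]
  rw [mul_comm, ← inner_conj_symm e w]

/-- `A` maps `e^⊥` into `e^⊥` when `A e = λ e` and `A` is self-adjoint. [folklore] -/
theorem inner_apply_eq_zero_of_orthogonal (hA : IsSelfAdjoint A) (hAe : A e = (lam : ℂ) • e) {v : H} (hv : ⟪e, v⟫_ℂ = 0) :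
    ⟪e, A v⟫_ℂ = 0 := by
  rw [← hA.adjoint_eq, ContinuousLinearMap.adjoint_inner_right, hAe, inner_smul_left, hv, mul_zero]

/-- ★ **The projected operator.**  With `Π = 1 − R`, `P := λ⁻¹ • (Π A Π)`: self-adjoint, compact if `A` is, `Re ⟪P v, v⟫ ≥ 0` if
`Re ⟪A v, v⟫ ≥ 0`, `P e = 0`, `P v = λ⁻¹ A v` and `⟪e, P v⟫ = 0` for `v ⊥ e`, and commuting with every operator `W` that fixes `e`,
satisfies `⟪e, W v⟫ = ⟪e, v⟫` and commutes with `A`. [folklore] -/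
theorem projected_props (hA : IsSelfAdjoint A) (hAc : IsCompactOperator A) (hApos : ∀ v, 0 ≤ RCLike.re ⟪A v, v⟫_ℂ)
    (he : ‖e‖ = 1) (hAe : A e = (lam : ℂ) • e) (hlam : 0 < lam) :
    IsSelfAdjoint (((lam : ℂ)⁻¹) • ((1 - (innerSL ℂ e).smulRight e) * A * (1 - (innerSL ℂ e).smulRight e)) : H →L[ℂ] H) ∧
    IsCompactOperator (((lam : ℂ)⁻¹) • ((1 - (innerSL ℂ e).smulRight e) * A * (1 - (innerSL ℂ e).smulRight e)) : H →L[ℂ] H) ∧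
    (∀ v, 0 ≤ RCLike.re ⟪(((lam : ℂ)⁻¹) • ((1 - (innerSL ℂ e).smulRight e) * A * (1 - (innerSL ℂ e).smulRight e)) : H →L[ℂ] H) v, v⟫_ℂ) ∧
    (((lam : ℂ)⁻¹) • ((1 - (innerSL ℂ e).smulRight e) * A * (1 - (innerSL ℂ e).smulRight e)) : H →L[ℂ] H) e = 0 ∧
    (∀ v, ⟪e, v⟫_ℂ = 0 →
      (((lam : ℂ)⁻¹) • ((1 - (innerSL ℂ e).smulRight e) * A * (1 - (innerSL ℂ e).smulRight e)) : H →L[ℂ] H) v = ((lam : ℂ)⁻¹) • A v) ∧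
    (∀ v, ⟪e, v⟫_ℂ = 0 →
      ⟪e, (((lam : ℂ)⁻¹) • ((1 - (innerSL ℂ e).smulRight e) * A * (1 - (innerSL ℂ e).smulRight e)) : H →L[ℂ] H) v⟫_ℂ = 0) ∧
    (∀ W : H →L[ℂ] H, W e = e → (∀ v, ⟪e, W v⟫_ℂ = ⟪e, v⟫_ℂ) → A * W = W * A →
      (((lam : ℂ)⁻¹) • ((1 - (innerSL ℂ e).smulRight e) * A * (1 - (innerSL ℂ e).smulRight e)) : H →L[ℂ] H) * W =
        W * (((lam : ℂ)⁻¹) • ((1 - (innerSL ℂ e).smulRight e) * A * (1 - (innerSL ℂ e).smulRight e)) : H →L[ℂ] H)) := by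
  have hPisa : IsSelfAdjoint (1 - (innerSL ℂ e).smulRight e : H →L[ℂ] H) := (IsSelfAdjoint.one _).sub (rankOne_isSelfAdjoint e)
  have hPie : (1 - (innerSL ℂ e).smulRight e : H →L[ℂ] H) e = 0 := by
    rw [sub_apply, one_apply_eq_self, rankOne_apply_self he, sub_self]
  have hPiv : ∀ v, ⟪e, v⟫_ℂ = 0 → (1 - (innerSL ℂ e).smulRight e : H →L[ℂ] H) v = v := fun v hv => by
    rw [sub_apply, one_apply_eq_self, rankOne_apply_of_orthogonal hv, sub_zero]
  have hPiorth : ∀ v, ⟪e, (1 - (innerSL ℂ e).smulRight e : H →L[ℂ] H) v⟫_ℂ = 0 := fun v => by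
    rw [sub_apply, one_apply_eq_self, rankOne_apply, inner_sub_right, inner_smul_right,
      inner_self_eq_norm_sq_to_K, he]
    simp
  have hMsa : IsSelfAdjoint ((1 - (innerSL ℂ e).smulRight e) * A * (1 - (innerSL ℂ e).smulRight e) : H →L[ℂ] H) :=
    IsSelfAdjoint.conjugate_self hA hPisa
  have hMsym := (ContinuousLinearMap.isSelfAdjoint_iff_isSymmetric.1 hMsa)
  have hPisym := (ContinuousLinearMap.isSelfAdjoint_iff_isSymmetric.1 hPisa)
  have hlamc : ((lam : ℂ)⁻¹) = (((lam⁻¹ : ℝ)) : ℂ) := by push_cast; rfl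
  refine ⟨?_, ?_, ?_, ?_, ?_, ?_, ?_⟩
  · -- self-adjoint
    rw [ContinuousLinearMap.isSelfAdjoint_iff_isSymmetric]
    intro v w
    have h := hMsym v w
    simp only [ContinuousLinearMap.coe_coe] at h
    simp only [ContinuousLinearMap.coe_coe, _root_.smul_apply, inner_smul_left, inner_smul_right]
    rw [h, hlamc, Complex.conj_ofReal]
  · -- compact
    exact ((hAc.comp_clm (1 - (innerSL ℂ e).smulRight e)).clm_comp (1 - (innerSL ℂ e).smulRight e)).smul ((lam : ℂ)⁻¹)
  · -- positive
    intro v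
    rw [_root_.smul_apply, inner_smul_left, hlamc, Complex.conj_ofReal, mul_apply_eq_comp,
      mul_apply_eq_comp, ← ContinuousLinearMap.coe_coe, hPisym, ContinuousLinearMap.coe_coe]
    have hp := hApos ((1 - (innerSL ℂ e).smulRight e : H →L[ℂ] H) v)
    rw [RCLike.re_to_complex] at hp ⊢
    rw [Complex.re_ofReal_mul]
    exact mul_nonneg (inv_nonneg.2 hlam.le) hp
  · -- `P e = 0`
    rw [_root_.smul_apply, mul_apply_eq_comp, mul_apply_eq_comp, hPie, map_zero, map_zero,
      smul_zero]
  · -- on `e^⊥`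
    intro v hv
    rw [_root_.smul_apply, mul_apply_eq_comp, mul_apply_eq_comp, hPiv v hv,
      hPiv _ (inner_apply_eq_zero_of_orthogonal hA hAe hv)]
  · intro v _
    rw [_root_.smul_apply, inner_smul_right, mul_apply_eq_comp, mul_apply_eq_comp, hPiorth,
      mul_zero]
  · -- commutation
    intro W hWe hWadj hAW
    have hRW := rankOne_comm hWe hWadj
    have hPiW : (1 - (innerSL ℂ e).smulRight e : H →L[ℂ] H) * W = W * (1 - (innerSL ℂ e).smulRight e) := by
      rw [sub_mul, mul_sub, one_mul, mul_one, hRW]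
    rw [smul_mul_assoc, mul_smul_comm]
    congr 1
    calc (1 - (innerSL ℂ e).smulRight e : H →L[ℂ] H) * A * (1 - (innerSL ℂ e).smulRight e) * W
        = (1 - (innerSL ℂ e).smulRight e) * A * ((1 - (innerSL ℂ e).smulRight e) * W) := by rw [mul_assoc]
      _ = (1 - (innerSL ℂ e).smulRight e) * (A * W) * (1 - (innerSL ℂ e).smulRight e) := by
          rw [hPiW]; simp only [mul_assoc]
      _ = ((1 - (innerSL ℂ e).smulRight e) * W) * A * (1 - (innerSL ℂ e).smulRight e) := by
          rw [hAW]; simp only [mul_assoc]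
      _ = W * ((1 - (innerSL ℂ e).smulRight e) * A * (1 - (innerSL ℂ e).smulRight e)) := by
          rw [hPiW]; simp only [mul_assoc]

/-! ## §2 The mixture identity of one reference state -/

variable {Γ : Type*} [AddCommGroup Γ]

omit [CompleteSpace H] in
/-- For a norm-preserving representation `⟪W γ u, v⟫ = ⟪u, W (−γ) v⟫`. [folklore] -/
theorem inner_rep_left' (W : Γ → H →L[ℂ] H) (hW0 : W 0 = 1) (hWadd : ∀ γ γ', W (γ + γ') = W γ * W γ')
    (hWnorm : ∀ γ v, ‖W γ v‖ = ‖v‖) (γ : Γ) (u v : H) : ⟪W γ u, v⟫_ℂ = ⟪u, W (-γ) v⟫_ℂ := by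
  have hiso : ∀ x y : H, ⟪W γ x, W γ y⟫_ℂ = ⟪x, y⟫_ℂ := (LinearMap.norm_map_iff_inner_map_map (W γ)).1 (hWnorm γ)
  have h1 : W γ (W (-γ) v) = v := by
    rw [← mul_apply_eq_comp, ← hWadd, add_neg_cancel, hW0, one_apply_eq_self]
  calc ⟪W γ u, v⟫_ℂ = ⟪W γ u, W γ (W (-γ) v)⟫_ℂ := by rw [h1]
    _ = ⟪u, W (-γ) v⟫_ℂ := hiso u _

omit [CompleteSpace H] in
/-- If `W` fixes `e` then `⟪e, W γ v⟫ = ⟪e, v⟫`. [folklore] -/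
theorem inner_rep_fixed (W : Γ → H →L[ℂ] H) (hW0 : W 0 = 1) (hWadd : ∀ γ γ', W (γ + γ') = W γ * W γ')
    (hWnorm : ∀ γ v, ‖W γ v‖ = ‖v‖) (hWe : ∀ γ, W γ e = e) (γ : Γ) (v : H) : ⟪e, W γ v⟫_ℂ = ⟪e, v⟫_ℂ := by
  rw [← inner_conj_symm, inner_rep_left' W hW0 hWadd hWnorm, hWe, inner_conj_symm]

/-- Powers of `P` on `e^⊥`: `P^j v = λ^{-j} A^j v` and `P^j v ⊥ e` for `v ⊥ e`. [folklore] -/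
theorem pow_projected_of_orthogonal (hA : IsSelfAdjoint A) (hAe : A e = (lam : ℂ) • e) {P : H →L[ℂ] H}
    (hPv : ∀ v, ⟪e, v⟫_ℂ = 0 → P v = ((lam : ℂ)⁻¹) • A v) (j : ℕ) {v : H} (hv : ⟪e, v⟫_ℂ = 0) :
    (P ^ j) v = ((lam : ℂ)⁻¹) ^ j • (A ^ j) v ∧ ⟪e, (A ^ j) v⟫_ℂ = 0 := by
  induction j with
  | zero => simp [hv]
  | succ j ih =>
    obtain ⟨ih1, ih2⟩ := ih
    refine ⟨?_, ?_⟩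
    · rw [pow_succ', pow_succ', pow_succ', mul_apply_eq_comp, mul_apply_eq_comp, ih1, map_smul,
        hPv _ ih2, smul_smul, mul_comm]
    · rw [pow_succ', mul_apply_eq_comp]
      exact inner_apply_eq_zero_of_orthogonal hA hAe ih2

/-- ★ **THE KÄLLÉN–LEHMANN DATUM OF ONE REFERENCE STATE.**  Let `A` be self-adjoint with unit eigenvector `A e = λ e`, `λ > 0`, let `W`
be a norm-preserving representation commuting with `A` and fixing `e`, let `P` satisfy `P v = λ⁻¹ A v` on `e^⊥`, be self-adjoint
and commute with `W`.  Then for every `ξ` and `t, t' ≥ 1`: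
`⟪W x ξ, A^{t+t'} (W y ξ)⟫ = λ^{t+t'} (|⟪e, ξ⟫|² + ⟪P^{t−1} (W x ψ), P^{t'−1} (W y ψ)⟫)` with `ψ = P (ξ − ⟪e,ξ⟫ e)`. [folklore] -/
theorem inner_pow_mixture (hA : IsSelfAdjoint A) (he : ‖e‖ = 1) (hAe : A e = (lam : ℂ) • e) (hlam : 0 < lam)
    (W : Γ → H →L[ℂ] H) (hW0 : W 0 = 1) (hWadd : ∀ γ γ', W (γ + γ') = W γ * W γ') (hWnorm : ∀ γ v, ‖W γ v‖ = ‖v‖)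
    (hWe : ∀ γ, W γ e = e) (hAW : ∀ γ, A * W γ = W γ * A)
    {P : H →L[ℂ] H} (hPsa : IsSelfAdjoint P) (hPv : ∀ v, ⟪e, v⟫_ℂ = 0 → P v = ((lam : ℂ)⁻¹) • A v)
    (hPW : ∀ γ, P * W γ = W γ * P) (ξ : H) (x y : Γ) {t t' : ℕ}
    (ht : 1 ≤ t) (ht' : 1 ≤ t') :
    ⟪W x ξ, (A ^ (t + t')) (W y ξ)⟫_ℂ =
      ((lam : ℂ) ^ (t + t')) * ((‖⟪e, ξ⟫_ℂ‖ ^ 2 : ℝ) +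
        ⟪(P ^ (t - 1)) (W x (P (ξ - ⟪e, ξ⟫_ℂ • e))), (P ^ (t' - 1)) (W y (P (ξ - ⟪e, ξ⟫_ℂ • e)))⟫_ℂ) := by
  -- the orthogonal decomposition `ξ = γ₀ e + ξ⊥`
  set γ₀ : ℂ := ⟪e, ξ⟫_ℂ with hγ₀
  set ξ' : H := ξ - γ₀ • e with hξ'
  have he2 : ⟪e, e⟫_ℂ = 1 := by rw [inner_self_eq_norm_sq_to_K, he]; simp
  have hξ'orth : ⟪e, ξ'⟫_ℂ = 0 := by rw [hξ', inner_sub_right, inner_smul_right, he2, mul_one, sub_self]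
  have hξdec : ξ = γ₀ • e + ξ' := by rw [hξ']; abel
  have hAsym := ContinuousLinearMap.isSelfAdjoint_iff_isSymmetric.1 hA
  have hPsym := ContinuousLinearMap.isSelfAdjoint_iff_isSymmetric.1 hPsa
  -- powers of `A` on `e` and self-adjointness of powers
  have hApow_e : ∀ j : ℕ, (A ^ j) e = ((lam : ℂ) ^ j) • e := fun j => by
    induction j with
    | zero => simp
    | succ j ih => rw [pow_succ', mul_apply_eq_comp, ih, map_smul, hAe, smul_smul, pow_succ, mul_comm]
  have hApow_sa : ∀ j : ℕ, IsSelfAdjoint (A ^ j) := fun j => hA.pow j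
  have hPpow_sa : ∀ j : ℕ, IsSelfAdjoint (P ^ j) := fun j => hPsa.pow j
  -- `W` preserves orthogonality to `e`
  have hWorth : ∀ γ v, ⟪e, v⟫_ℂ = 0 → ⟪e, W γ v⟫_ℂ = 0 := fun γ v hv => by
    rw [inner_rep_fixed W hW0 hWadd hWnorm hWe, hv]
  -- `A^j` commutes with `W`, `P^j` commutes with `W`
  have hApowW : ∀ (j : ℕ) γ, (A ^ j) * W γ = W γ * (A ^ j) := fun j γ => by
    induction j with
    | zero => simp
    | succ j ih => rw [pow_succ, mul_assoc, hAW, ← mul_assoc, ih, mul_assoc]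
  have hPpowW : ∀ (j : ℕ) γ, (P ^ j) * W γ = W γ * (P ^ j) := fun j γ => by
    induction j with
    | zero => simp
    | succ j ih => rw [pow_succ, mul_assoc, hPW, ← mul_assoc, ih, mul_assoc]
  -- expand
  set m := t + t' with hm
  have hWx : W x ξ = γ₀ • e + W x ξ' := by rw [hξdec, map_add, map_smul, hWe]
  have hWy : (A ^ m) (W y ξ) = (γ₀ * (lam : ℂ) ^ m) • e + (A ^ m) (W y ξ') := by
    rw [hξdec, map_add, map_smul, hWe, map_add, map_smul, hApow_e, smul_smul]
  have hcross1 : ⟪e, (A ^ m) (W y ξ')⟫_ℂ = 0 := by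
    rw [← (hApow_sa m).adjoint_eq, ContinuousLinearMap.adjoint_inner_right, hApow_e, inner_smul_left, hWorth y _ hξ'orth, mul_zero]
  have hcross2 : ⟪W x ξ', e⟫_ℂ = 0 := by
    rw [← inner_conj_symm, hWorth x _ hξ'orth, map_zero]
  -- the orthogonal part: `A^m = λ^m P^m` on `e^⊥`, then split the power
  have hWyorth : ⟪e, W y ξ'⟫_ℂ = 0 := hWorth y _ hξ'orth
  obtain ⟨hPm, -⟩ := pow_projected_of_orthogonal hA hAe hPv m hWyorth
  have hAm : (A ^ m) (W y ξ') = ((lam : ℂ) ^ m) • (P ^ m) (W y ξ') := by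
    rw [hPm, smul_smul, ← mul_pow, mul_inv_cancel₀ (by exact_mod_cast hlam.ne'), one_pow, one_smul]
  have hsplit : ⟪W x ξ', (P ^ m) (W y ξ')⟫_ℂ =
      ⟪(P ^ (t - 1)) (W x (P ξ')), (P ^ (t' - 1)) (W y (P ξ'))⟫_ℂ := by
    obtain ⟨a, rfl⟩ : ∃ a, t = a + 1 := ⟨t - 1, by omega⟩
    obtain ⟨a', rfl⟩ : ∃ a', t' = a' + 1 := ⟨t' - 1, by omega⟩
    simp only [Nat.add_sub_cancel]
    have h1 : (P ^ m) = (P ^ (a + 1)) * (P ^ (a' + 1)) := by rw [← pow_add]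
    have hPWv : ∀ γ (v : H), P (W γ v) = W γ (P v) := fun γ v => by
      rw [← mul_apply_eq_comp, hPW, mul_apply_eq_comp]
    rw [h1, mul_apply_eq_comp, ← ContinuousLinearMap.adjoint_inner_left, (hPpow_sa (a + 1)).adjoint_eq, pow_succ, pow_succ,
      mul_apply_eq_comp, mul_apply_eq_comp, hPWv, hPWv]
  have key : ⟪γ₀ • e + W x ξ', (γ₀ * (lam : ℂ) ^ m) • e + (A ^ m) (W y ξ')⟫_ℂ =
      conj γ₀ * (γ₀ * (lam : ℂ) ^ m) + ⟪W x ξ', (A ^ m) (W y ξ')⟫_ℂ := by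
    simp only [inner_add_left, inner_add_right, inner_smul_left, inner_smul_right]
    rw [he2, hcross1, hcross2]; ring
  rw [hWx, hWy, key, hAm, inner_smul_right, hsplit]
  have hn : (((‖γ₀‖ ^ 2 : ℝ)) : ℂ) = conj γ₀ * γ₀ := by rw [RCLike.conj_mul]; norm_cast
  rw [hn]; ring

end Summit.QuantumFields.YangMills.Theorems.TorusKL.MixtureAlgebra

end
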